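import Literature.Probability.RandomPlanarGeometry.SAWBubbleBound
import Literature.Probability.RandomPlanarGeometry.SelfAvoidingWalkProofs

/-!
# First-exit inequality for self-avoiding walks of `ℤ²` relative to a subgraph — worker helper for the
stub `criticalExitMass` (line `exit-mass-unforced-dive`, crux `SAWTotalPositivity.TPToTraversalBound`,
stmt-CriticalPhenomena-10687)

Self-avoiding walks are vertex LISTS (`SAW.Zd.IsSAW`, `SAW.Zd.paths` of `SAWBubbleBound.lean`).  For a
graph `G` on `Site 2 = ℤ²` (in the application `G = Ω_δ = discreteDomainGraph Ω δ`), a site `p`, a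
fugacity `x ≥ 0` and `S_N := Σ_{n ≤ N} cₙ xⁿ`, this file proves (`firstExit_sum_le`, the registered
helper stub): for every finite set `D` of lists containing every self-avoiding `G`-walk list from `p`,

  `S_N ≤ Σ_{γ ∈ D} x^{|γ|} + x · (Σ_{γ ∈ D} e_G(end γ) x^{|γ|}) · S_N`,

`|γ| = γ.length - 1` the number of steps, `end γ = γ.getLast?.getD 0`, and
`e_G(y) = #{y' | y ∼ y' in ℤ², ¬ G.Adj y y'}` the exterior degree.  PROOF (Madras–Slade 1993 §1.2 style
splitting).  The SAW lists of `ℤ²` from `q` with at most `N` steps form a finset `Sf N q` (translates of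
`SAW.Zd.paths 2 n`, `n ≤ N`; below `Sf` is any family of finsets with this membership, `mem_saws`), and
`Σ_{ω ∈ Sf N q} x^{|ω|} = S_N` (`sum_saws`, translation invariance and `#paths 2 n = cₙ`).  A SAW `ω` of
`ℤ²` from `p` either is a `G`-walk (so `ω ∈ D`) or splits at the number of sites `k` of its longest
initial `G`-segment into a `G`-SAW prefix from `p` ending at `y = ω_{k-1}`, an exterior edge
`y → y' = ω_k` and a SAW suffix of `ℤ²` from `y'` with at most `N` steps (`first_exit`);
`ω = prefix ++ suffix` makes this injective and `x^{|ω|} = x^{|prefix|} · x · x^{|suffix|}`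
(`fiber_le`, `sum_saws_le`).  Also exported: `exists_finset_saws` and `succ_le_sum_count_mul_pow`
(`S_N ≥ N + 1` at `x = x_c`, from `μⁿ ≤ cₙ`).

Sources: N. Madras, G. Slade, *The Self-Avoiding Walk* (1993), §1.2; B. Simon, Commun. Math. Phys. 77
(1980) 111–126 and E. H. Lieb, ibid. 127–135 (the finite-size criterion this inequality serves).
No definitions and no notation: everything is a theorem.
-/

noncomputable section

open scoped BigOperators
open Literature.Probability.LatticeModels
open Literature.Probability.RandomPlanarGeometry

namespace Summit.CriticalPhenomena.SAWScalingLimit.Theorems.TPToTraversalBound.ExitMass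

/-! ## Self-avoiding walks of `ℤ²` from a point, as vertex lists -/

/-- The translates by `q` of the lists `SAW.Zd.paths 2 n`, `n ≤ N`, are exactly the self-avoiding
vertex lists from `q` with at most `N + 1` sites. [folklore] -/
private theorem mem_saws {N : ℕ} {q : Site 2} {l : List (Site 2)} :
    l ∈ Finset.image (fun l : List (Site 2) => List.map (fun y : Site 2 => y + q) l)
        (Finset.biUnion (Finset.range (N + 1)) fun n => SAW.Zd.paths 2 n) ↔
      SAW.Zd.IsSAW 2 l ∧ l.head? = some q ∧ l.length ≤ N + 1 := by
  constructor
  · intro hl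
    obtain ⟨l', hl', rfl⟩ := Finset.mem_image.1 hl
    obtain ⟨n, hn, hln⟩ := Finset.mem_biUnion.1 hl'
    obtain ⟨hsaw, hlen, hhead⟩ := SAW.Zd.mem_paths_iff.1 hln
    refine ⟨hsaw.map_add q, by rw [List.head?_map, hhead]; simp, ?_⟩
    rw [List.length_map, hlen]
    have := Finset.mem_range.1 hn
    omega
  · rintro ⟨hsaw, hhead, hlen⟩
    have hpos := hsaw.length_pos
    refine Finset.mem_image.2 ⟨l.map fun y => y + -q, Finset.mem_biUnion.2 ⟨l.length - 1, ?_, ?_⟩, ?_⟩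
    · rw [Finset.mem_range]; omega
    · refine SAW.Zd.mem_paths_iff.2 ⟨hsaw.map_add (-q), by rw [List.length_map]; omega, ?_⟩
      rw [List.head?_map, hhead]; simp
    · rw [List.map_map]
      exact List.map_id'' (fun y => by simp) l

/-- The self-avoiding walk lists of `ℤ²` from `q` with at most `N` steps form a finite set. [folklore] -/
theorem exists_finset_saws (N : ℕ) (q : Site 2) : ∃ F : Finset (List (Site 2)),
    ∀ l : List (Site 2), l ∈ F ↔ SAW.Zd.IsSAW 2 l ∧ l.head? = some q ∧ l.length ≤ N + 1 :=
  ⟨_, fun _ => mem_saws⟩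

/-- At `x = x_c = 1/μ`: `cₙ x_cⁿ ≥ (μ x_c)ⁿ = 1`, so `Σ_{n ≤ N} cₙ x_cⁿ ≥ N + 1`
(`μⁿ ≤ cₙ`, Madras–Slade (1.2.10)). [cite: MadrasSlade1993, §1.2, eq. (1.2.10)] -/
theorem succ_le_sum_count_mul_pow (N : ℕ) :
    (N : ℝ) + 1 ≤ ∑ n ∈ Finset.range (N + 1), (SAW.Zd.count 2 n : ℝ) * SAW.criticalFugacity ^ n := by
  have hμ : 0 < SAW.connectiveConstant := by linarith [SAW.two_le_connectiveConstant]
  have hx : SAW.connectiveConstant * SAW.criticalFugacity = 1 := mul_inv_cancel₀ hμ.ne'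
  have hx0 : 0 ≤ SAW.criticalFugacity := SAW.criticalFugacity_pos_lt_one'.1.le
  calc (N : ℝ) + 1 = ∑ _n ∈ Finset.range (N + 1), (1 : ℝ) := by simp
    _ ≤ _ := Finset.sum_le_sum fun n _ => by
      have h := SAW.Zd.pow_connectiveConstant_le_count 2 n
      rw [SAW.Zd.connectiveConstant_two] at h
      calc (1 : ℝ) = SAW.connectiveConstant ^ n * SAW.criticalFugacity ^ n := by
            rw [← mul_pow, hx, one_pow]
        _ ≤ _ := mul_le_mul_of_nonneg_right h (pow_nonneg hx0 n)

/-! ## The first-exit decomposition relative to a subgraph `G`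

`Sf N q` is any finset of lists with the membership of `mem_saws` (hypothesis `hS`). -/

section FirstExit

variable (Sf : ℕ → Site 2 → Finset (List (Site 2)))
  (hS : ∀ (N : ℕ) (q : Site 2) (l : List (Site 2)),
    l ∈ Sf N q ↔ SAW.Zd.IsSAW 2 l ∧ l.head? = some q ∧ l.length ≤ N + 1)
  (G : SimpleGraph (Site 2))

include hS

/-- `Σ_{ω ∈ Sf N q} x^{|ω|} = Σ_{n ≤ N} cₙ xⁿ`: translation invariance of `ℤ²` and `#paths 2 n = cₙ`.
[cite: MadrasSlade1993, §1.2] -/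
private theorem sum_saws (N : ℕ) (q : Site 2) (x : ℝ) :
    ∑ l ∈ Sf N q, x ^ (l.length - 1) = ∑ n ∈ Finset.range (N + 1), (SAW.Zd.count 2 n : ℝ) * x ^ n := by
  rw [show Sf N q = _ from Finset.ext fun l => (hS N q l).trans mem_saws.symm,
    Finset.sum_image fun l₁ _ l₂ _ h => (List.map_injective_iff.2 (add_left_injective q)) h,
    Finset.sum_biUnion]
  · refine Finset.sum_congr rfl fun n _ => ?_
    rw [Finset.sum_congr rfl (g := fun _ => x ^ n) fun l hl => by
      rw [List.length_map, (SAW.Zd.mem_paths_iff.1 hl).2.1, Nat.add_sub_cancel],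
      Finset.sum_const, SAW.Zd.card_paths, nsmul_eq_mul]
  · intro n _ m _ hnm
    refine Finset.disjoint_left.2 fun l hln hlm => hnm ?_
    have h1 := (SAW.Zd.mem_paths_iff.1 hln).2.1
    have h2 := (SAW.Zd.mem_paths_iff.1 hlm).2.1
    omega

/-- Walks from different starting points are different. [folklore] -/
private theorem disjoint_saws {N : ℕ} {y₁ y₂ : Site 2} (h : y₁ ≠ y₂) :
    Disjoint (Sf N y₁) (Sf N y₂) :=
  Finset.disjoint_left.2 fun l h₁ h₂ => h <| by
    have e₁ := ((hS N y₁ l).1 h₁).2.1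
    have e₂ := ((hS N y₂ l).1 h₂).2.1
    rw [e₁, Option.some_inj] at e₂
    exact e₂

/-- **First-exit decomposition** of a self-avoiding walk `l` of `ℤ²` from `p` that is not a walk of
`G`: with `k` the number of sites of the longest initial `G`-segment of `l`, the prefix `l.take k` is a
self-avoiding `G`-walk list from `p`, the step `l[k-1] → l[k]` is an exterior edge at the end of the
prefix, the suffix `l.drop k` is a SAW of `ℤ²` from `l[k]` with at most `N` steps, and
`|l| - 1 = (|prefix| - 1) + 1 + (|suffix| - 1)`. [cite: MadrasSlade1993, §1.2] -/
private theorem first_exit {N : ℕ} {p : Site 2} {l : List (Site 2)} (hl : l ∈ Sf N p)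
    (hG : ¬ l.IsChain G.Adj) : ∃ k : ℕ,
    (SAW.Zd.IsSAW 2 (l.take k) ∧ (l.take k).head? = some p ∧ (l.take k).IsChain G.Adj) ∧
    (∃ y' : Site 2, ((zdGraph 2).Adj ((l.take k).getLast?.getD 0) y' ∧
        ¬ G.Adj ((l.take k).getLast?.getD 0) y') ∧ l.drop k ∈ Sf N y') ∧
    l.length - 1 = ((l.take k).length - 1 + 1) + ((l.drop k).length - 1) := by
  classical
  obtain ⟨hsaw, hhead, hlen⟩ := (hS N p l).1 hl
  have hne : l ≠ [] := hsaw.ne_nil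
  -- `k` = the number of sites of the longest initial `G`-segment
  set k := Nat.findGreatest (fun k => (l.take k).IsChain G.Adj) l.length with hk
  have htake : (l.take k).IsChain G.Adj :=
    Nat.findGreatest_spec (P := fun k => (l.take k).IsChain G.Adj) (Nat.zero_le _) (by simp)
  have hk1 : 1 ≤ k := by
    refine Nat.le_findGreatest (P := fun k => (l.take k).IsChain G.Adj) (List.length_pos_iff.2 hne) ?_
    obtain ⟨a, t, rfl⟩ := List.exists_cons_of_ne_nil hne
    simp
  have hkl : k < l.length := by
    refine lt_of_le_of_ne (Nat.findGreatest_le _) fun heq => hG ?_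
    rwa [heq, List.take_length] at htake
  have hnot : ¬ (l.take (k + 1)).IsChain G.Adj :=
    Nat.findGreatest_is_greatest (P := fun k => (l.take k).IsChain G.Adj) (Nat.lt_succ_self _) hkl
  refine ⟨k, ?_⟩
  obtain ⟨j, hj⟩ : ∃ j, k = j + 1 := ⟨k - 1, by omega⟩
  rw [hj] at hnot htake hkl ⊢
  have hjl : j < l.length := by omega
  -- the exterior step `l[j] → l[j+1]`
  have hzd : (zdGraph 2).Adj l[j] l[j + 1] := hsaw.isChain.getElem j hkl
  have hlast : (l.take (j + 1)).getLast? = some l[j] := by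
    rw [List.getLast?_take, if_neg (Nat.succ_ne_zero j), Nat.add_sub_cancel,
      List.getElem?_eq_getElem hjl, Option.some_or]
  have hnG : ¬ G.Adj l[j] l[j + 1] := by
    intro hadj
    rw [List.take_succ_eq_append_getElem hkl] at hnot
    refine hnot (List.IsChain.append htake (List.isChain_singleton _) ?_)
    intro a ha b hb
    rw [hlast, Option.mem_def, Option.some_inj] at ha
    rw [List.head?_cons, Option.mem_def, Option.some_inj] at hb
    rw [← ha, ← hb]
    exact hadj
  refine ⟨⟨hsaw.take (Nat.succ_ne_zero j), ?_, htake⟩, ⟨l[j + 1], ?_, ?_⟩, ?_⟩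
  · rw [List.head?_take, if_neg (Nat.succ_ne_zero j), hhead]
  · rw [hlast, Option.getD_some]
    exact ⟨hzd, hnG⟩
  · rw [hS]
    refine ⟨hsaw.drop hkl, ?_, ?_⟩
    · rw [List.head?_drop, List.getElem?_eq_getElem hkl]
    · rw [List.length_drop]; omega
  · rw [List.length_take, List.length_drop]; omega

/-- The fibre bound of the first-exit decomposition: over walks `l` with a fixed prefix
`γ = l.take (cut l)` whose suffix `l.drop (cut l)` starts at an exterior neighbour of the end of `γ`,
the map `l ↦ suffix` is injective (`l = γ ++ suffix`), so `Σ_l x^{|suffix l|} ≤ e_G(end γ) · S_N`.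
[cite: MadrasSlade1993, §1.2] -/
private theorem fiber_le {N : ℕ} {x : ℝ} (hx : 0 ≤ x) (γ : List (Site 2))
    (cut : List (Site 2) → ℕ) (F : Finset (List (Site 2)))
    (hF : ∀ l ∈ F, (∃ y' : Site 2, ((zdGraph 2).Adj (γ.getLast?.getD 0) y' ∧
        ¬ G.Adj (γ.getLast?.getD 0) y') ∧ l.drop (cut l) ∈ Sf N y') ∧ l.take (cut l) = γ) :
    ∑ l ∈ F, x ^ ((l.drop (cut l)).length - 1) ≤
      ({y' : Site 2 | (zdGraph 2).Adj (γ.getLast?.getD 0) y' ∧ ¬ G.Adj (γ.getLast?.getD 0) y'}.ncard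
        : ℝ) * ∑ n ∈ Finset.range (N + 1), (SAW.Zd.count 2 n : ℝ) * x ^ n := by
  classical
  set y₀ := γ.getLast?.getD 0
  set X := ((zdGraph 2).neighborFinset y₀).filter fun y' => ¬ G.Adj y₀ y' with hX
  have hmemX : ∀ y', y' ∈ X ↔ (zdGraph 2).Adj y₀ y' ∧ ¬ G.Adj y₀ y' := fun y' => by
    rw [hX, Finset.mem_filter, SimpleGraph.mem_neighborFinset]
  have hcard : (X.card : ℝ) = {y' : Site 2 | (zdGraph 2).Adj y₀ y' ∧ ¬ G.Adj y₀ y'}.ncard := by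
    rw [← Set.ncard_coe_finset]
    congr 2
    ext y'
    rw [Finset.mem_coe, hmemX, Set.mem_setOf_eq]
  calc ∑ l ∈ F, x ^ ((l.drop (cut l)).length - 1)
      = ∑ ω ∈ F.image fun l => l.drop (cut l), x ^ (ω.length - 1) := by
        rw [Finset.sum_image]
        intro l₁ h₁ l₂ h₂ h
        have h : l₁.drop (cut l₁) = l₂.drop (cut l₂) := h
        calc l₁ = l₁.take (cut l₁) ++ l₁.drop (cut l₁) := (List.take_append_drop _ _).symm
          _ = l₂.take (cut l₂) ++ l₂.drop (cut l₂) := by rw [(hF l₁ h₁).2, (hF l₂ h₂).2, h]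
          _ = l₂ := List.take_append_drop _ _
    _ ≤ ∑ ω ∈ X.biUnion fun y' => Sf N y', x ^ (ω.length - 1) := by
        refine Finset.sum_le_sum_of_subset_of_nonneg ?_ fun _ _ _ => pow_nonneg hx _
        intro ω hω
        obtain ⟨l, hl, rfl⟩ := Finset.mem_image.1 hω
        obtain ⟨⟨y', hy', hmem⟩, -⟩ := hF l hl
        exact Finset.mem_biUnion.2 ⟨y', (hmemX y').2 hy', hmem⟩
    _ = ∑ y' ∈ X, ∑ ω ∈ Sf N y', x ^ (ω.length - 1) :=
        Finset.sum_biUnion fun _ _ _ _ h => disjoint_saws Sf hS h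
    _ = _ := by
        rw [Finset.sum_congr rfl fun y' _ => sum_saws Sf hS N y' x, Finset.sum_const, nsmul_eq_mul,
          hcard]

/-- **First-exit inequality** `S_N(p) ≤ C + x · E · S_N`: the SAWs of `ℤ²` from `p` with at most `N`
steps either are walks of `G` (hence in `D`, mass `≤ C = Σ_{γ ∈ D} x^{|γ|}`) or decompose at their first
exterior edge (mass `≤ x · Σ_{γ ∈ D} e_G(end γ) x^{|γ|} · S_N`, `S_N = Σ_{n ≤ N} cₙ xⁿ`).
[cite: MadrasSlade1993, §1.2] -/
private theorem sum_saws_le (N : ℕ) (p : Site 2) (D : Finset (List (Site 2)))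
    (hD : ∀ l : List (Site 2), SAW.Zd.IsSAW 2 l → l.head? = some p → l.IsChain G.Adj → l ∈ D)
    {x : ℝ} (hx : 0 ≤ x) :
    ∑ l ∈ Sf N p, x ^ (l.length - 1) ≤
      ∑ γ ∈ D, x ^ (γ.length - 1) +
        x * (∑ γ ∈ D, ({y' : Site 2 | (zdGraph 2).Adj (γ.getLast?.getD 0) y' ∧
            ¬ G.Adj (γ.getLast?.getD 0) y'}.ncard : ℝ) * x ^ (γ.length - 1)) *
          ∑ n ∈ Finset.range (N + 1), (SAW.Zd.count 2 n : ℝ) * x ^ n := by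
  classical
  set S := ∑ n ∈ Finset.range (N + 1), (SAW.Zd.count 2 n : ℝ) * x ^ n
  rw [← Finset.sum_filter_add_sum_filter_not (Sf N p) fun l => l.IsChain G.Adj]
  refine add_le_add (Finset.sum_le_sum_of_subset_of_nonneg (fun l hl => ?_)
    fun _ _ _ => pow_nonneg hx _) ?_
  · obtain ⟨hl, hG⟩ := Finset.mem_filter.1 hl
    obtain ⟨hsaw, hhead, -⟩ := (hS N p l).1 hl
    exact hD l hsaw hhead hG
  set B := (Sf N p).filter fun l => ¬ l.IsChain G.Adj with hB
  -- choose the cut of every bad walk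
  have hex : ∀ l : List (Site 2), ∃ k : ℕ, l ∈ B →
      (SAW.Zd.IsSAW 2 (l.take k) ∧ (l.take k).head? = some p ∧ (l.take k).IsChain G.Adj) ∧
      (∃ y' : Site 2, ((zdGraph 2).Adj ((l.take k).getLast?.getD 0) y' ∧
          ¬ G.Adj ((l.take k).getLast?.getD 0) y') ∧ l.drop k ∈ Sf N y') ∧
      l.length - 1 = ((l.take k).length - 1 + 1) + ((l.drop k).length - 1) := by
    intro l
    by_cases h : l ∈ B
    · obtain ⟨h1, h2⟩ := Finset.mem_filter.1 h
      obtain ⟨k, hk⟩ := first_exit Sf hS G h1 h2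
      exact ⟨k, fun _ => hk⟩
    · exact ⟨0, fun h' => (h h').elim⟩
  choose cut hcut using hex
  have hpreD : ∀ l ∈ B, l.take (cut l) ∈ D := fun l hl => by
    obtain ⟨h1, h2, h3⟩ := (hcut l hl).1
    exact hD _ h1 h2 h3
  calc ∑ l ∈ B, x ^ (l.length - 1)
      = ∑ l ∈ B, x ^ ((l.take (cut l)).length - 1) * (x * x ^ ((l.drop (cut l)).length - 1)) := by
        refine Finset.sum_congr rfl fun l hl => ?_
        rw [(hcut l hl).2.2, pow_add, pow_add, pow_one, mul_assoc]
    _ = ∑ γ ∈ D, ∑ l ∈ B with l.take (cut l) = γ,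
          x ^ ((l.take (cut l)).length - 1) * (x * x ^ ((l.drop (cut l)).length - 1)) :=
        (Finset.sum_fiberwise_of_maps_to hpreD _).symm
    _ ≤ ∑ γ ∈ D, x ^ (γ.length - 1) * (x * (({y' : Site 2 | (zdGraph 2).Adj (γ.getLast?.getD 0) y' ∧
            ¬ G.Adj (γ.getLast?.getD 0) y'}.ncard : ℝ) * S)) := by
        refine Finset.sum_le_sum fun γ _ => ?_
        rw [Finset.sum_congr rfl (g := fun l => x ^ (γ.length - 1) *
            (x * x ^ ((l.drop (cut l)).length - 1))) fun l hl => by rw [(Finset.mem_filter.1 hl).2],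
          ← Finset.mul_sum, ← Finset.mul_sum]
        refine mul_le_mul_of_nonneg_left (mul_le_mul_of_nonneg_left ?_ hx) (pow_nonneg hx _)
        refine fiber_le Sf hS G hx γ cut _ fun l hl => ?_
        obtain ⟨hlB, hlγ⟩ := Finset.mem_filter.1 hl
        obtain ⟨-, hy, -⟩ := hcut l hlB
        rw [hlγ] at hy
        exact ⟨hy, hlγ⟩
    _ = _ := by
        rw [Finset.mul_sum D, Finset.sum_mul D]
        exact Finset.sum_congr rfl fun γ _ => by ring

end FirstExit

/-- **The first-exit inequality** (worker helper stub for `criticalExitMass`): for a graph `G` on `ℤ²`,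
a site `p` and a finite set `D` of vertex lists containing every self-avoiding `G`-walk list from `p`,
for every `x ≥ 0` and `N`,
`S_N ≤ Σ_{γ ∈ D} x^{|γ|} + x · (Σ_{γ ∈ D} e_G(end γ) x^{|γ|}) · S_N` with `S_N = Σ_{n ≤ N} cₙ xⁿ`,
`|γ| = γ.length - 1`, `end γ = γ.getLast?.getD 0` and `e_G(y) = #{y' | y ∼ y' in ℤ², ¬ G.Adj y y'}`
(for `G = Ω_δ` this is `exteriorDegree Ω δ y`). [cite: MadrasSlade1993, §1.2] -/
theorem firstExit_sum_le : ∀ (G : SimpleGraph (Site 2)) (p : Site 2) (D : Finset (List (Site 2))),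
    (∀ l : List (Site 2), SAW.Zd.IsSAW 2 l → l.head? = some p → l.IsChain G.Adj → l ∈ D) →
    ∀ (x : ℝ), 0 ≤ x → ∀ (N : ℕ),
      ∑ n ∈ Finset.range (N + 1), (SAW.Zd.count 2 n : ℝ) * x ^ n ≤
        ∑ γ ∈ D, x ^ (γ.length - 1) +
          x * (∑ γ ∈ D, ({y' : Site 2 | (zdGraph 2).Adj (γ.getLast?.getD 0) y' ∧
              ¬ G.Adj (γ.getLast?.getD 0) y'}.ncard : ℝ) * x ^ (γ.length - 1)) *
            ∑ n ∈ Finset.range (N + 1), (SAW.Zd.count 2 n : ℝ) * x ^ n := by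
  intro G p D hD x hx N
  have hS : ∀ (N : ℕ) (q : Site 2) (l : List (Site 2)),
      l ∈ Finset.image (fun l : List (Site 2) => List.map (fun y : Site 2 => y + q) l)
        (Finset.biUnion (Finset.range (N + 1)) fun n => SAW.Zd.paths 2 n) ↔
      SAW.Zd.IsSAW 2 l ∧ l.head? = some q ∧ l.length ≤ N + 1 := fun _ _ _ => mem_saws
  have h := sum_saws_le _ hS G N p D hD hx
  rwa [sum_saws _ hS N p x] at h

end Summit.CriticalPhenomena.SAWScalingLimit.Theorems.TPToTraversalBound.ExitMass

end
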